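import Mathlib
import HarnessLib
import Summits.HubbardSuperconductivity.HubbardSuperconductivity.Theorems.KLProgrammeKLRegimeTwoVolumeTowerStepCovZero
import Summits.HubbardSuperconductivity.HubbardSuperconductivity.Theorems.KLProgrammeKLRegimeSectorSliceRowsMomentGeneric
import Summits.HubbardSuperconductivity.HubbardSuperconductivity.Theorems.KLProgrammeKLRegimeTwoVolumeTowerStepCovSectionalPieces
import Summits.HubbardSuperconductivity.HubbardSuperconductivity.Theorems.KLProgrammeKLRegimeFrameShellCount
import Summits.HubbardSuperconductivity.HubbardSuperconductivity.Theorems.KLProgrammeKLRegimeSectorSliceFamilyDefectPlain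

/-!
# K3 VL child `KLRegimeVolumeLimitV17F2` (stmt-HubbardSuperconductivity-20440), located item «SCALE-0-STEPCOV», part 1 (PULLBACK): at the first step
# `k = 0` the tower's step covariance is the pull-back of the plain slice `C^K_{(Λ₂,Λ₁]}` through the CONSTANT multiplier `𝟙` — EXACTLY, at every
# frame — so its frame increment is the plain normal covariance with symbol `(βV²)⁻²·(Ψ̂[K′] − Ψ̂[K])`; weighted rows / columns / sectional rows of both
# reduce to ONE isotropic character sum; support counts of the plain symbol and of its increment on the product torus

Cell `gate-hubbard-kl`, seat p3 (g17).  The `cov` fields of `TowerVolumeDataT(S)` / `TowerCrossData` at `j = 0` (`ScaleCovData (klStepCov V M β μ K_V 0) …`,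
`ScaleCovSecData …`; DISCHARGER-GUIDE-g14 §1) are served at `k ≥ 1` by p3's anisotropic doors; at `k = 0` the scale-`0` fat multiplier is the radial plateau
(`bgmFatMultiplier_zero_mul_sliceSymbolFnXi`, p3 g12), and the rows need — like every shallow step at the TOP flow frame `K_n`, where `‖D³e_{K_n}‖` is not
volume-free (located finding «W2-HALF») — the frame telescope `klStepCov[K_n] 0 = klStepCov[K_1] 0 + Σ_{1≤i<n} (klStepCov[K_{i+1}] 0 − klStepCov[K_i] 0)`.
This file is the matrix-level bookkeeping of that telescope at scale `0`:

* §1 `pullback_normalCovariance_congr` — two (multiplier, symbol) pairs with the same products `F_ω F_{ω′} p` have the same pull-back (the closed form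
  `sectorSub_pullback_normalCovariance_apply`); **`klStepCov_zero_eq_pullback_one`** — `klStepCov V M β μ K 0 = S(𝟙)ᵀ·C^K_{(Λ₂,Λ₁]}·S(𝟙)` for EVERY frame
  `K` (`β ≠ 0`); **`klStepCov_zero_sub_eq`** — `klStepCov[K′] 0 − klStepCov[K] 0 = S(𝟙)ᵀ·N(Ψ̂[K′] − Ψ̂[K])·S(𝟙)` (k3c3-p2 `hubbardCovSliceCT_sub_eq_normalCovariance`);
* §2 weighted rows / columns (`≤ 16·T`) and sectional rows (`≤ 2·T`) of `S(𝟙)ᵀ·N(P)·S(𝟙)` for ANY spin-free symbol `P` from ONE weighted `ℓ¹` bound `T` of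
  the character sum of `(βV²)⁻²·P` (k3c3-p2's generic reductions at `F = 𝟙`, two sector copies): `rowSumWt_/colSumWt_/secRowWt_pullback_one_le`; hence
  **`colSumWt_klStepCov_zero_le`** (the column twin of p3 g12's `rowSumWt_klStepCov_zero_le`) and **`rowSumWt_/colSumWt_/secRowWt_klStepCov_zero_sub_le`**
  for the increment;
* §3 **`card_support_sliceSymbolTorus_le`** — on an admissible frame (`FrameOK`, clause (i) only) the plain symbol `q ↦ Ψ̂_{(Λ,Λ′]}(ω(q₁), e_K(q₂))` on
  `(ℤ/2M)¹ × (ℤ/V)²` is supported on `≤ (Λ′β/π + 3)·(1793Λ′V² + 704V)` points (`0 < Λ ≤ Λ′ < 3/80`; Matsubara count × closed-shell level count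
  `card_frameLevel_le_le`); **`card_support_sliceSymbolTorusIncr_le`** — the increment between two admissible frames on at most twice that.

Everything is proved; no definitions, no sorry.  Nothing asserts any stub, K3, VL or superconductivity.
[cite: BenfattoGiulianiMastropietro2006, §2.7 (2.66)–(2.67), §2.8 (2.80)–(2.81), §3 (3.3)]
-/

noncomputable section

namespace Summit.HubbardSuperconductivity.HubbardSuperconductivity.Theorems.TorusFourierL2

set_option linter.dupNamespace false -- summit = problem name (single-conjunct summit), D-0017

open Set Finset Literature.MathematicalPhysics.QuantumLattice Literature.MathematicalPhysics.QuantumLattice.BandSectorCounting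
open Literature.MathematicalPhysics.QuantumLattice.FermiRG Literature.Probability.LatticeModels Literature.Analysis.SpecialFunctions
open Summit.HubbardSuperconductivity.HubbardSuperconductivity.Theorems.DispersionFlow
open Summit.HubbardSuperconductivity.HubbardSuperconductivity.Theorems.KLRegimeSplit
open Summit.HubbardSuperconductivity.HubbardSuperconductivity.Theorems.KLProgrammeLegKernels
open Summit.HubbardSuperconductivity.HubbardSuperconductivity.Theorems.PerturbedFermiCurve
open Summit.HubbardSuperconductivity.HubbardSuperconductivity.Theorems.KLRegimeWick
open Summit.HubbardSuperconductivity.HubbardSuperconductivity.Theorems.TwoVolumeSource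
open scoped Real Nat

open Classical

/-! ## §1 The step covariance at scale `0` is the pull-back through the constant multiplier -/

section Pullback

variable {V M N : ℕ} [NeZero V] [NeZero M]

omit [NeZero M] in
/-- **Two (multiplier, symbol) pairs with the same products have the same pull-back**: if `F_ω(k)F_{ω′}(k)p(k,σ) = F′_ω(k)F′_{ω′}(k)p′(k,σ)` for all
`ω, ω′, k, σ`, then `S(F)ᵀ·N(p)·S(F) = S(F′)ᵀ·N(p′)·S(F′)` (the closed form of the sectorised propagators reads only these products).
[cite: BenfattoGiulianiMastropietro2006, §2.7 (2.66)] -/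
theorem pullback_normalCovariance_congr (β : ℝ) (F F' : Fin N → FreqMomentum V M → ℂ) (p p' : FreqMomentum V M × Fin 2 → ℂ)
    (h : ∀ (ω ω' : Fin N) (k : FreqMomentum V M) (σ : Fin 2), F ω k * F ω' k * p (k, σ) = F' ω k * F' ω' k * p' (k, σ)) :
    (sectorSubMatrix V M β F).transpose * normalCovariance V M p * sectorSubMatrix V M β F =
      (sectorSubMatrix V M β F').transpose * normalCovariance V M p' * sectorSubMatrix V M β F' := by
  ext Y Y'
  rw [sectorSub_pullback_normalCovariance_apply, sectorSub_pullback_normalCovariance_apply]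
  by_cases hσ : Y.2.1.2 = Y'.2.1.2
  · rw [if_pos hσ, if_pos hσ]
    refine Finset.sum_congr rfl fun k _ => ?_
    have hk := h Y.2.1.1 Y'.2.1.1 k Y.2.1.2
    set c₀ : ℂ := ((1 / (β * (V : ℝ) ^ 2) : ℝ) : ℂ)
    set a := (starRingEnd ℂ) (hubbardPlaneWave V M β Y.2.2 k Y.1)
    set b := (starRingEnd ℂ) (hubbardPlaneWave V M β Y'.2.2 k Y'.1)
    by_cases h01 : Y.2.2 = 0 ∧ Y'.2.2 = 1
    · rw [if_pos h01, if_pos h01]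
      calc c₀ * (F Y.2.1.1 k * a) * p (k, Y.2.1.2) * (c₀ * (F Y'.2.1.1 k * b))
          = c₀ * c₀ * a * b * (F Y.2.1.1 k * F Y'.2.1.1 k * p (k, Y.2.1.2)) := by ring
        _ = c₀ * c₀ * a * b * (F' Y.2.1.1 k * F' Y'.2.1.1 k * p' (k, Y.2.1.2)) := by rw [hk]
        _ = c₀ * (F' Y.2.1.1 k * a) * p' (k, Y.2.1.2) * (c₀ * (F' Y'.2.1.1 k * b)) := by ring
    · rw [if_neg h01, if_neg h01]
      by_cases h10 : Y.2.2 = 1 ∧ Y'.2.2 = 0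
      · rw [if_pos h10, if_pos h10]
        calc c₀ * (F Y.2.1.1 k * a) * -p (k, Y.2.1.2) * (c₀ * (F Y'.2.1.1 k * b))
            = -(c₀ * c₀ * a * b * (F Y.2.1.1 k * F Y'.2.1.1 k * p (k, Y.2.1.2))) := by ring
          _ = -(c₀ * c₀ * a * b * (F' Y.2.1.1 k * F' Y'.2.1.1 k * p' (k, Y.2.1.2))) := by rw [hk]
          _ = c₀ * (F' Y.2.1.1 k * a) * -p' (k, Y.2.1.2) * (c₀ * (F' Y'.2.1.1 k * b)) := by ring
      · rw [if_neg h10, if_neg h10, mul_zero, zero_mul, mul_zero, zero_mul]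
  · rw [if_neg hσ, if_neg hσ]

omit [NeZero M] in
/-- **THE FIRST STEP COVARIANCE IS THE PULL-BACK OF THE PLAIN SLICE THROUGH THE CONSTANT MULTIPLIER**: for every frame `K` and `β ≠ 0`,
`klStepCov V M β μ K 0 = S(𝟙)ᵀ·C^K_{(Λ₂,Λ₁]}·S(𝟙)` — on the slice's support both scale-`0` fat multipliers are `1`, off it the symbol vanishes
(`bgmFatMultiplier_zero_mul_sliceSymbolFnXi`). [cite: BenfattoGiulianiMastropietro2006, §2.5 (2.45), §2.7 (2.66), (2.70)] -/
theorem klStepCov_zero_eq_pullback_one {β : ℝ} (hβ : β ≠ 0) (μ : ℝ) (K : TrigPolyC4v) :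
    klStepCov V M β μ K 0 =
      (sectorSubMatrix V M β (fun (_ : Fin (sectorCount 0)) (_ : FreqMomentum V M) => (1 : ℂ))).transpose *
          hubbardCovSliceCT V M β μ 0 K (klScale klE0 2) (klScale klE0 1) *
        sectorSubMatrix V M β (fun (_ : Fin (sectorCount 0)) (_ : FreqMomentum V M) => (1 : ℂ)) := by
  have he : (0 : ℝ) < klE0 := by norm_num [klE0]
  have hΛ2 : 0 < klScale klE0 2 := klth_klScale_pos 2
  have hΛ21 : klScale klE0 2 ≤ klScale klE0 1 := EngineV8.klScale_le_klScale he.le (by norm_num)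
  have hΛ1e : klScale klE0 1 ≤ klE0 := klScale_le_e0 he.le 1
  show (sectorSubMatrix V M β (bgmFatMultiplier V M klE0 β (nambuXiCT V μ K) 0)).transpose *
      hubbardCovSliceCT V M β μ 0 K (klScale klE0 2) (klScale klE0 1) *
      sectorSubMatrix V M β (bgmFatMultiplier V M klE0 β (nambuXiCT V μ K) 0) = _
  rw [hubbardCovSliceCT_eq_normalCovariance_sliceSymbolFnXi hβ μ K]
  refine pullback_normalCovariance_congr β _ _ _ _ fun ω ω' k σ => ?_
  obtain ⟨i, q⟩ := k
  rw [one_mul, one_mul]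
  exact bgmFatMultiplier_zero_mul_sliceSymbolFnXi he β μ K hΛ2 hΛ21 hΛ1e _ _ ω ω' i q

omit [NeZero M] in
/-- **The frame increment of the first step covariance is the plain normal covariance with the symbol increment**:
`klStepCov V M β μ K′ 0 − klStepCov V M β μ K 0 = S(𝟙)ᵀ·N(ks ↦ Ψ̂_{(Λ₂,Λ₁]}(ω(ks), e_{K′}(k⃗)) − Ψ̂_{(Λ₂,Λ₁]}(ω(ks), e_K(k⃗)))·S(𝟙)`.
[cite: BenfattoGiulianiMastropietro2006, §3 (3.3)] -/
theorem klStepCov_zero_sub_eq {β : ℝ} (hβ : β ≠ 0) (μ : ℝ) (K K' : TrigPolyC4v) :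
    klStepCov V M β μ K' 0 - klStepCov V M β μ K 0 =
      (sectorSubMatrix V M β (fun (_ : Fin (sectorCount 0)) (_ : FreqMomentum V M) => (1 : ℂ))).transpose *
          normalCovariance V M (fun ks =>
            sliceSymbolFnXi (β * (V : ℝ) ^ 2) 0 (klScale klE0 2) (klScale klE0 1) (matsubaraFreq β M ks.1.1) (nambuXiCT V μ K' ks.1.2) -
              sliceSymbolFnXi (β * (V : ℝ) ^ 2) 0 (klScale klE0 2) (klScale klE0 1) (matsubaraFreq β M ks.1.1) (nambuXiCT V μ K ks.1.2)) *
        sectorSubMatrix V M β (fun (_ : Fin (sectorCount 0)) (_ : FreqMomentum V M) => (1 : ℂ)) := by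
  rw [klStepCov_zero_eq_pullback_one hβ μ K', klStepCov_zero_eq_pullback_one hβ μ K, ← hubbardCovSliceCT_sub_eq_normalCovariance hβ μ K K',
    Matrix.mul_sub, Matrix.sub_mul]

end Pullback

/-! ## §2 Weighted rows / columns / sectional rows of a constant-multiplier pull-back from ONE character sum -/

section Rows

variable {V M : ℕ} [NeZero V] [NeZero M]

/-- The sum of a constant over the two scale-`0` sector copies. -/
private theorem sum_const_sectorCount_zero (T : ℝ) : ∑ _ω : Fin (sectorCount 0), T = 2 * T := by
  rw [Finset.sum_const, Finset.card_univ, Fintype.card_fin]; simp [sectorCount]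

/-- **Weighted rows of `S(𝟙)ᵀ·N(P)·S(𝟙)`** (any spin-free symbol `P(ω, k⃗)`, any nonnegative even weight `w` on the product torus): from
`Σ_z w(z)·‖Σ_q χ_{q₁}(z₁)χ_{q₂}(z₂) • (βV²)⁻²P(ω(q₁), q₂)‖ ≤ T`, every row is `≤ 16·T` (two sector copies `ω′`, orientation factor `8`).
[cite: BenfattoGiulianiMastropietro2006, §2.7 (2.66)–(2.67)] -/
theorem rowSumWt_pullback_one_le {β : ℝ} (hβ : β ≠ 0) (P : ℝ → TorusSite 2 V → ℂ) (w : TorusSite 1 (2 * M) × TorusSite 2 V → ℝ)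
    (hw0 : ∀ z, 0 ≤ w z) (hw : ∀ a b, w (-a, -b) = w (a, b)) {T : ℝ}
    (hT : ∑ z : TorusSite 1 (2 * M) × TorusSite 2 V, w z *
        ‖∑ q : TorusSite 1 (2 * M) × TorusSite 2 V, (torusChar q.1 z.1 * torusChar q.2 z.2) •
          (((1 / (β * (V : ℝ) ^ 2) : ℝ) : ℂ) ^ 2 * P (matsubaraFreq β M ⟨(q.1 0).val, ZMod.val_lt (q.1 0)⟩) q.2)‖ ≤ T)
    (X : SpaceTimeIdx V M × SectorLeg (sectorCount 0)) :
    ∑ Y : SpaceTimeIdx V M × SectorLeg (sectorCount 0),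
        ‖((sectorSubMatrix V M β (fun (_ : Fin (sectorCount 0)) (_ : FreqMomentum V M) => (1 : ℂ))).transpose *
            normalCovariance V M (fun ks => P (matsubaraFreq β M ks.1.1) ks.1.2) *
            sectorSubMatrix V M β (fun (_ : Fin (sectorCount 0)) (_ : FreqMomentum V M) => (1 : ℂ))) X Y‖ *
          w ((fun _ : Fin 1 => ((X.1.1 : ℕ) : ZMod (2 * M)) - ((Y.1.1 : ℕ) : ZMod (2 * M))), X.1.2 - Y.1.2) ≤ 16 * T := by
  refine (rowSumWt_norm_pullback_normalCovariance_le hβ P (fun (_ : Fin (sectorCount 0)) (_ : FreqMomentum V M) => (1 : ℂ)) w hw0 hw X).trans ?_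
  simp only [one_mul]
  rw [sum_const_sectorCount_zero]
  linarith

/-- **Weighted columns of `S(𝟙)ᵀ·N(P)·S(𝟙)`** from the same `T`: every column is `≤ 16·T`. [cite: BenfattoGiulianiMastropietro2006, §2.7 (2.66)–(2.67)] -/
theorem colSumWt_pullback_one_le {β : ℝ} (hβ : β ≠ 0) (P : ℝ → TorusSite 2 V → ℂ) (w : TorusSite 1 (2 * M) × TorusSite 2 V → ℝ)
    (hw0 : ∀ z, 0 ≤ w z) (hw : ∀ a b, w (-a, -b) = w (a, b)) {T : ℝ}
    (hT : ∑ z : TorusSite 1 (2 * M) × TorusSite 2 V, w z *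
        ‖∑ q : TorusSite 1 (2 * M) × TorusSite 2 V, (torusChar q.1 z.1 * torusChar q.2 z.2) •
          (((1 / (β * (V : ℝ) ^ 2) : ℝ) : ℂ) ^ 2 * P (matsubaraFreq β M ⟨(q.1 0).val, ZMod.val_lt (q.1 0)⟩) q.2)‖ ≤ T)
    (Y : SpaceTimeIdx V M × SectorLeg (sectorCount 0)) :
    ∑ X : SpaceTimeIdx V M × SectorLeg (sectorCount 0),
        ‖((sectorSubMatrix V M β (fun (_ : Fin (sectorCount 0)) (_ : FreqMomentum V M) => (1 : ℂ))).transpose *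
            normalCovariance V M (fun ks => P (matsubaraFreq β M ks.1.1) ks.1.2) *
            sectorSubMatrix V M β (fun (_ : Fin (sectorCount 0)) (_ : FreqMomentum V M) => (1 : ℂ))) X Y‖ *
          w ((fun _ : Fin 1 => ((X.1.1 : ℕ) : ZMod (2 * M)) - ((Y.1.1 : ℕ) : ZMod (2 * M))), X.1.2 - Y.1.2) ≤ 16 * T := by
  refine (colSumWt_norm_pullback_normalCovariance_le hβ P (fun (_ : Fin (sectorCount 0)) (_ : FreqMomentum V M) => (1 : ℂ)) w hw0 hw Y).trans ?_
  simp only [one_mul]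
  rw [sum_const_sectorCount_zero]
  linarith

/-- **Sectional weighted rows of `S(𝟙)ᵀ·N(p)·S(𝟙)`** (any symbol `p`, any nonnegative even spatial weight `w`): from the fixed-time bounds
`Σ_{z₂} w(z₂)·‖Σ_q χ_{q₁}(z₁)χ_{q₂}(z₂) • (βV²)⁻²p(q, σ)‖ ≤ T` at every `z₁` and spin `σ`, every sectional row is `≤ 2·T`.
[cite: BenfattoGiulianiMastropietro2006, §2.7 (2.66)–(2.67)] -/
theorem secRowWt_pullback_one_le {β : ℝ} (hβ : β ≠ 0) (p : FreqMomentum V M × Fin 2 → ℂ) (w : TorusSite 2 V → ℝ) (hw0 : ∀ z, 0 ≤ w z)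
    (hw : ∀ b, w (-b) = w b) {T : ℝ}
    (hT : ∀ (σ : Fin 2) (z₁ : TorusSite 1 (2 * M)), ∑ z₂ : TorusSite 2 V, w z₂ *
        ‖∑ q : TorusSite 1 (2 * M) × TorusSite 2 V, (torusChar q.1 z₁ * torusChar q.2 z₂) •
          (((1 / (β * (V : ℝ) ^ 2) : ℝ) : ℂ) ^ 2 * p ((⟨(q.1 0).val, ZMod.val_lt (q.1 0)⟩, q.2), σ))‖ ≤ T)
    (X : SpaceTimeIdx V M × SectorLeg (sectorCount 0)) (t : ImagTimeIdx M) (ℓ : SectorLeg (sectorCount 0)) :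
    ∑ y : TorusSite 2 V,
        ‖((sectorSubMatrix V M β (fun (_ : Fin (sectorCount 0)) (_ : FreqMomentum V M) => (1 : ℂ))).transpose * normalCovariance V M p *
            sectorSubMatrix V M β (fun (_ : Fin (sectorCount 0)) (_ : FreqMomentum V M) => (1 : ℂ))) X ((t, y), ℓ)‖ * w (X.1.2 - y) ≤ 2 * T := by
  refine secRowWt_norm_pullback_normalCovariance_le hβ (fun (_ : Fin (sectorCount 0)) (_ : FreqMomentum V M) => (1 : ℂ)) p w hw0 hw X t ℓ fun z₁ => ?_
  simp only [one_mul]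
  exact hT X.2.1.2 z₁

/-- **Weighted COLUMNS of the first step covariance reduce to the PLAIN slice kernel** (the column twin of p3 g12's `rowSumWt_klStepCov_zero_le`):
for every nonnegative even weight `w` on the product torus, if `Σ_z w(z)·‖Σ_q χ_{q₁}(z₁)χ_{q₂}(z₂) • ((βV²)⁻²·Ψ̂_{(Λ₂,Λ₁]})‖ ≤ T`, then
`Σ_{X} ‖klStepCov V M β μ K 0 X Y‖·w(x − y) ≤ 16·T`. [cite: BenfattoGiulianiMastropietro2006, §2.7 (2.66)–(2.67)] -/
theorem colSumWt_klStepCov_zero_le {β : ℝ} (hβ : β ≠ 0) (μ : ℝ) (K : TrigPolyC4v) (w : TorusSite 1 (2 * M) × TorusSite 2 V → ℝ)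
    (hw0 : ∀ z, 0 ≤ w z) (hw : ∀ a b, w (-a, -b) = w (a, b)) {T : ℝ}
    (hT : ∑ z : TorusSite 1 (2 * M) × TorusSite 2 V, w z *
        ‖∑ q : TorusSite 1 (2 * M) × TorusSite 2 V, (torusChar q.1 z.1 * torusChar q.2 z.2) •
          ((((1 / (β * (V : ℝ) ^ 2) : ℝ) : ℂ) ^ 2 *
            sliceSymbolFnXi (β * (V : ℝ) ^ 2) 0 (klScale klE0 2) (klScale klE0 1) (matsubaraFreq β M ⟨(q.1 0).val, ZMod.val_lt (q.1 0)⟩)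
              (nambuXiCT V μ K q.2)))‖ ≤ T)
    (Y : SpaceTimeIdx V M × SectorLeg (sectorCount 0)) :
    ∑ X : SpaceTimeIdx V M × SectorLeg (sectorCount 0),
        ‖klStepCov V M β μ K 0 X Y‖ * w ((fun _ : Fin 1 => ((X.1.1 : ℕ) : ZMod (2 * M)) - ((Y.1.1 : ℕ) : ZMod (2 * M))), X.1.2 - Y.1.2) ≤
      16 * T := by
  rw [klStepCov_zero_eq_pullback_one hβ μ K, hubbardCovSliceCT_eq_normalCovariance_sliceSymbolFnXi hβ μ K]
  exact colSumWt_pullback_one_le hβ (fun ω k => sliceSymbolFnXi (β * (V : ℝ) ^ 2) 0 (klScale klE0 2) (klScale klE0 1) ω (nambuXiCT V μ K k))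
    w hw0 hw hT Y

/-- **Weighted ROWS of the first step covariance from the plain kernel, constant `16`** (p3 g12's `rowSumWt_klStepCov_zero_le` restated through §1; `β ≠ 0`).
[cite: BenfattoGiulianiMastropietro2006, §2.7 (2.66)–(2.67)] -/
theorem rowSumWt_klStepCov_zero_le' {β : ℝ} (hβ : β ≠ 0) (μ : ℝ) (K : TrigPolyC4v) (w : TorusSite 1 (2 * M) × TorusSite 2 V → ℝ)
    (hw0 : ∀ z, 0 ≤ w z) (hw : ∀ a b, w (-a, -b) = w (a, b)) {T : ℝ}
    (hT : ∑ z : TorusSite 1 (2 * M) × TorusSite 2 V, w z *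
        ‖∑ q : TorusSite 1 (2 * M) × TorusSite 2 V, (torusChar q.1 z.1 * torusChar q.2 z.2) •
          ((((1 / (β * (V : ℝ) ^ 2) : ℝ) : ℂ) ^ 2 *
            sliceSymbolFnXi (β * (V : ℝ) ^ 2) 0 (klScale klE0 2) (klScale klE0 1) (matsubaraFreq β M ⟨(q.1 0).val, ZMod.val_lt (q.1 0)⟩)
              (nambuXiCT V μ K q.2)))‖ ≤ T)
    (X : SpaceTimeIdx V M × SectorLeg (sectorCount 0)) :
    ∑ Y : SpaceTimeIdx V M × SectorLeg (sectorCount 0),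
        ‖klStepCov V M β μ K 0 X Y‖ * w ((fun _ : Fin 1 => ((X.1.1 : ℕ) : ZMod (2 * M)) - ((Y.1.1 : ℕ) : ZMod (2 * M))), X.1.2 - Y.1.2) ≤
      16 * T := by
  rw [klStepCov_zero_eq_pullback_one hβ μ K, hubbardCovSliceCT_eq_normalCovariance_sliceSymbolFnXi hβ μ K]
  exact rowSumWt_pullback_one_le hβ (fun ω k => sliceSymbolFnXi (β * (V : ℝ) ^ 2) 0 (klScale klE0 2) (klScale klE0 1) ω (nambuXiCT V μ K k))
    w hw0 hw hT X

/-- **Weighted ROWS of the frame increment of the first step covariance** from one weighted `ℓ¹` bound `T` of the character sum of the symbol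
increment `(βV²)⁻²·(Ψ̂[K′] − Ψ̂[K])`: `Σ_Y ‖(klStepCov[K′] 0 − klStepCov[K] 0) X Y‖·w(x − y) ≤ 16·T`. [cite: BenfattoGiulianiMastropietro2006, §3 (3.3)] -/
theorem rowSumWt_klStepCov_zero_sub_le {β : ℝ} (hβ : β ≠ 0) (μ : ℝ) (K K' : TrigPolyC4v) (w : TorusSite 1 (2 * M) × TorusSite 2 V → ℝ)
    (hw0 : ∀ z, 0 ≤ w z) (hw : ∀ a b, w (-a, -b) = w (a, b)) {T : ℝ}
    (hT : ∑ z : TorusSite 1 (2 * M) × TorusSite 2 V, w z *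
        ‖∑ q : TorusSite 1 (2 * M) × TorusSite 2 V, (torusChar q.1 z.1 * torusChar q.2 z.2) •
          ((((1 / (β * (V : ℝ) ^ 2) : ℝ) : ℂ) ^ 2 *
            (sliceSymbolFnXi (β * (V : ℝ) ^ 2) 0 (klScale klE0 2) (klScale klE0 1) (matsubaraFreq β M ⟨(q.1 0).val, ZMod.val_lt (q.1 0)⟩)
                (nambuXiCT V μ K' q.2) -
              sliceSymbolFnXi (β * (V : ℝ) ^ 2) 0 (klScale klE0 2) (klScale klE0 1) (matsubaraFreq β M ⟨(q.1 0).val, ZMod.val_lt (q.1 0)⟩)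
                (nambuXiCT V μ K q.2))))‖ ≤ T)
    (X : SpaceTimeIdx V M × SectorLeg (sectorCount 0)) :
    ∑ Y : SpaceTimeIdx V M × SectorLeg (sectorCount 0), ‖(klStepCov V M β μ K' 0 - klStepCov V M β μ K 0) X Y‖ *
        w ((fun _ : Fin 1 => ((X.1.1 : ℕ) : ZMod (2 * M)) - ((Y.1.1 : ℕ) : ZMod (2 * M))), X.1.2 - Y.1.2) ≤ 16 * T := by
  rw [klStepCov_zero_sub_eq hβ μ K K']
  exact rowSumWt_pullback_one_le hβ (fun ω k => sliceSymbolFnXi (β * (V : ℝ) ^ 2) 0 (klScale klE0 2) (klScale klE0 1) ω (nambuXiCT V μ K' k) -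
    sliceSymbolFnXi (β * (V : ℝ) ^ 2) 0 (klScale klE0 2) (klScale klE0 1) ω (nambuXiCT V μ K k)) w hw0 hw hT X

/-- **Weighted COLUMNS of the frame increment of the first step covariance** from the same `T`: `≤ 16·T`. [cite: BenfattoGiulianiMastropietro2006, §3 (3.3)] -/
theorem colSumWt_klStepCov_zero_sub_le {β : ℝ} (hβ : β ≠ 0) (μ : ℝ) (K K' : TrigPolyC4v) (w : TorusSite 1 (2 * M) × TorusSite 2 V → ℝ)
    (hw0 : ∀ z, 0 ≤ w z) (hw : ∀ a b, w (-a, -b) = w (a, b)) {T : ℝ}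
    (hT : ∑ z : TorusSite 1 (2 * M) × TorusSite 2 V, w z *
        ‖∑ q : TorusSite 1 (2 * M) × TorusSite 2 V, (torusChar q.1 z.1 * torusChar q.2 z.2) •
          ((((1 / (β * (V : ℝ) ^ 2) : ℝ) : ℂ) ^ 2 *
            (sliceSymbolFnXi (β * (V : ℝ) ^ 2) 0 (klScale klE0 2) (klScale klE0 1) (matsubaraFreq β M ⟨(q.1 0).val, ZMod.val_lt (q.1 0)⟩)
                (nambuXiCT V μ K' q.2) -
              sliceSymbolFnXi (β * (V : ℝ) ^ 2) 0 (klScale klE0 2) (klScale klE0 1) (matsubaraFreq β M ⟨(q.1 0).val, ZMod.val_lt (q.1 0)⟩)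
                (nambuXiCT V μ K q.2))))‖ ≤ T)
    (Y : SpaceTimeIdx V M × SectorLeg (sectorCount 0)) :
    ∑ X : SpaceTimeIdx V M × SectorLeg (sectorCount 0), ‖(klStepCov V M β μ K' 0 - klStepCov V M β μ K 0) X Y‖ *
        w ((fun _ : Fin 1 => ((X.1.1 : ℕ) : ZMod (2 * M)) - ((Y.1.1 : ℕ) : ZMod (2 * M))), X.1.2 - Y.1.2) ≤ 16 * T := by
  rw [klStepCov_zero_sub_eq hβ μ K K']
  exact colSumWt_pullback_one_le hβ (fun ω k => sliceSymbolFnXi (β * (V : ℝ) ^ 2) 0 (klScale klE0 2) (klScale klE0 1) ω (nambuXiCT V μ K' k) -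
    sliceSymbolFnXi (β * (V : ℝ) ^ 2) 0 (klScale klE0 2) (klScale klE0 1) ω (nambuXiCT V μ K k)) w hw0 hw hT Y

/-- **Sectional weighted ROWS of the frame increment of the first step covariance** from fixed-time bounds `T` of the increment character sum (every `z₁`):
`Σ_y ‖(klStepCov[K′] 0 − klStepCov[K] 0) X ((t,y),ℓ)‖·w(x⃗ − y) ≤ 2·T`. [cite: BenfattoGiulianiMastropietro2006, §3 (3.3)] -/
theorem secRowWt_klStepCov_zero_sub_le {β : ℝ} (hβ : β ≠ 0) (μ : ℝ) (K K' : TrigPolyC4v) (w : TorusSite 2 V → ℝ) (hw0 : ∀ z, 0 ≤ w z)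
    (hw : ∀ b, w (-b) = w b) {T : ℝ}
    (hT : ∀ z₁ : TorusSite 1 (2 * M), ∑ z₂ : TorusSite 2 V, w z₂ *
        ‖∑ q : TorusSite 1 (2 * M) × TorusSite 2 V, (torusChar q.1 z₁ * torusChar q.2 z₂) •
          ((((1 / (β * (V : ℝ) ^ 2) : ℝ) : ℂ) ^ 2 *
            (sliceSymbolFnXi (β * (V : ℝ) ^ 2) 0 (klScale klE0 2) (klScale klE0 1) (matsubaraFreq β M ⟨(q.1 0).val, ZMod.val_lt (q.1 0)⟩)
                (nambuXiCT V μ K' q.2) -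
              sliceSymbolFnXi (β * (V : ℝ) ^ 2) 0 (klScale klE0 2) (klScale klE0 1) (matsubaraFreq β M ⟨(q.1 0).val, ZMod.val_lt (q.1 0)⟩)
                (nambuXiCT V μ K q.2))))‖ ≤ T)
    (X : SpaceTimeIdx V M × SectorLeg (sectorCount 0)) (t : ImagTimeIdx M) (ℓ : SectorLeg (sectorCount 0)) :
    ∑ y : TorusSite 2 V, ‖(klStepCov V M β μ K' 0 - klStepCov V M β μ K 0) X ((t, y), ℓ)‖ * w (X.1.2 - y) ≤ 2 * T := by
  rw [klStepCov_zero_sub_eq hβ μ K K']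
  refine secRowWt_pullback_one_le hβ (fun ks : FreqMomentum V M × Fin 2 =>
    sliceSymbolFnXi (β * (V : ℝ) ^ 2) 0 (klScale klE0 2) (klScale klE0 1) (matsubaraFreq β M ks.1.1) (nambuXiCT V μ K' ks.1.2) -
      sliceSymbolFnXi (β * (V : ℝ) ^ 2) 0 (klScale klE0 2) (klScale klE0 1) (matsubaraFreq β M ks.1.1) (nambuXiCT V μ K ks.1.2)) w hw0 hw
    (fun σ z₁ => ?_) X t ℓ
  dsimp only
  exact hT z₁

/-- **Sectional weighted ROWS of the first step covariance itself** from fixed-time bounds of the plain character sum (constant `2`; p3 g12's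
`secRowWt_klStepCov_zero_le` with `β ≠ 0`). [cite: BenfattoGiulianiMastropietro2006, §2.7 (2.66)–(2.67)] -/
theorem secRowWt_klStepCov_zero_le' {β : ℝ} (hβ : β ≠ 0) (μ : ℝ) (K : TrigPolyC4v) (w : TorusSite 2 V → ℝ) (hw0 : ∀ z, 0 ≤ w z)
    (hw : ∀ b, w (-b) = w b) {T : ℝ}
    (hT : ∀ z₁ : TorusSite 1 (2 * M), ∑ z₂ : TorusSite 2 V, w z₂ *
        ‖∑ q : TorusSite 1 (2 * M) × TorusSite 2 V, (torusChar q.1 z₁ * torusChar q.2 z₂) •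
          ((((1 / (β * (V : ℝ) ^ 2) : ℝ) : ℂ) ^ 2 *
            sliceSymbolFnXi (β * (V : ℝ) ^ 2) 0 (klScale klE0 2) (klScale klE0 1) (matsubaraFreq β M ⟨(q.1 0).val, ZMod.val_lt (q.1 0)⟩)
              (nambuXiCT V μ K q.2)))‖ ≤ T)
    (X : SpaceTimeIdx V M × SectorLeg (sectorCount 0)) (t : ImagTimeIdx M) (ℓ : SectorLeg (sectorCount 0)) :
    ∑ y : TorusSite 2 V, ‖klStepCov V M β μ K 0 X ((t, y), ℓ)‖ * w (X.1.2 - y) ≤ 2 * T := by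
  rw [klStepCov_zero_eq_pullback_one hβ μ K, hubbardCovSliceCT_eq_normalCovariance_sliceSymbolFnXi hβ μ K]
  refine secRowWt_pullback_one_le hβ (fun ks : FreqMomentum V M × Fin 2 =>
    sliceSymbolFnXi (β * (V : ℝ) ^ 2) 0 (klScale klE0 2) (klScale klE0 1) (matsubaraFreq β M ks.1.1) (nambuXiCT V μ K ks.1.2)) w hw0 hw
    (fun σ z₁ => ?_) X t ℓ
  dsimp only
  exact hT z₁

end Rows

/-! ## §3 Support counts of the plain symbol and of its increment on the product torus -/

section Support

variable {V M : ℕ} [NeZero V] [NeZero M]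

omit [NeZero V] [NeZero M] in
/-- Off the closed shell `{|ω| ≤ Λ′} × {|ξ| ≤ Λ′}` the slice symbol vanishes. [cite: BenfattoGiulianiMastropietro2006, §2.3 (2.19)] -/
theorem sliceSymbolFnXi_eq_zero_of_not_shell {c Λ Λ' ω ξ : ℝ} (hΛ : 0 < Λ) (hΛΛ' : Λ ≤ Λ') (h : ¬(|ω| ≤ Λ' ∧ |ξ| ≤ Λ')) :
    sliceSymbolFnXi c 0 Λ Λ' ω ξ = 0 := by
  have hΛ' : 0 ≤ Λ' := hΛ.le.trans hΛΛ'
  have hout : Λ' ^ 2 < ξ ^ 2 + ω ^ 2 := by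
    by_contra hle
    have hle' : ξ ^ 2 + ω ^ 2 ≤ Λ' ^ 2 := not_lt.mp hle
    apply h
    have hω2 : ω ^ 2 ≤ Λ' ^ 2 := by nlinarith [sq_nonneg ξ]
    have hξ2 : ξ ^ 2 ≤ Λ' ^ 2 := by nlinarith [sq_nonneg ω]
    exact ⟨abs_le_of_sq_le_sq hω2 hΛ', abs_le_of_sq_le_sq hξ2 hΛ'⟩
  have h0 := (sliceWeightFn_eq_zero_of_not_mem hΛ hΛΛ' (ξ := ω) (ω := ξ) (Or.inr hout)).1
  simp [sliceSymbolFnXi, h0]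

/-- **Support count of the plain slice symbol on the product torus** (admissible frame, clause (i) of `FrameOK` only): for `0 < Λ ≤ Λ′ < 3/80`,
`#{q : Ψ̂_{(Λ,Λ′]}(ω(q₁), e_K(q₂)) ≠ 0} ≤ (Λ′β/π + 3)·(1793Λ′V² + 704V)` (Matsubara count × closed-shell level count).
[cite: BenfattoGiulianiMastropietro2006, §2.8 (2.80)] -/
theorem card_support_sliceSymbolTorus_le {R : RenConsts} {U : ℝ} {N : ℕ} {μ : ℝ} {K : TrigPolyC4v} (hK : FrameOK R U N μ K)
    {β : ℝ} (hβ : 0 < β) (c : ℝ) {Λ Λ' : ℝ} (hΛ : 0 < Λ) (hΛΛ' : Λ ≤ Λ') (hΛ' : Λ' < 3 / 80) :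
    ((((univ : Finset (TorusSite 1 (2 * M) × TorusSite 2 V)).filter fun q =>
        sliceSymbolFnXi c 0 Λ Λ' (matsubaraFreq β M ⟨(q.1 0).val, ZMod.val_lt (q.1 0)⟩) (nambuXiCT V μ K q.2) ≠ 0).card : ℕ) : ℝ) ≤
      (Λ' * β / π + 3) * (1793 * Λ' * (V : ℝ) ^ 2 + 704 * V) := by
  classical
  have hΛ'0 : 0 ≤ Λ' := hΛ.le.trans hΛΛ'
  -- the support is inside the shell, read through the injective label map
  have hsub : ((univ : Finset (TorusSite 1 (2 * M) × TorusSite 2 V)).filter fun q =>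
        sliceSymbolFnXi c 0 Λ Λ' (matsubaraFreq β M ⟨(q.1 0).val, ZMod.val_lt (q.1 0)⟩) (nambuXiCT V μ K q.2) ≠ 0) ⊆
      (univ : Finset (TorusSite 1 (2 * M) × TorusSite 2 V)).filter fun q =>
        (fun k : FreqMomentum V M => |matsubaraFreq β M k.1| ≤ Λ' ∧ |nambuXiCT V μ K k.2| ≤ Λ') (⟨(q.1 0).val, ZMod.val_lt (q.1 0)⟩, q.2) := by
    intro q hq
    rw [mem_filter] at hq ⊢
    refine ⟨mem_univ _, ?_⟩
    by_contra h
    exact hq.2 (sliceSymbolFnXi_eq_zero_of_not_shell hΛ hΛΛ' h)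
  have h1 := Finset.card_le_card hsub
  have h2 := card_filter_prodTorus_le_card_filter (L := V) (M := M)
    (fun k : FreqMomentum V M => |matsubaraFreq β M k.1| ≤ Λ' ∧ |nambuXiCT V μ K k.2| ≤ Λ')
  have h3 := card_filter_freqMomentum_eq (L := V) (M := M) (fun i : MatsubaraIdx M => |matsubaraFreq β M i| ≤ Λ')
    (fun k : TorusSite 2 V => |nambuXiCT V μ K k| ≤ Λ')
  have hT : ((((univ : Finset (MatsubaraIdx M)).filter fun i => |matsubaraFreq β M i| ≤ Λ').card : ℕ) : ℝ) ≤ Λ' * β / π + 3 :=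
    card_filter_matsubaraFreq_le hβ hΛ'0 _ fun i hi => (mem_filter.1 hi).2
  have hS : ((((univ : Finset (TorusSite 2 V)).filter fun k => |nambuXiCT V μ K k| ≤ Λ').card : ℕ) : ℝ) ≤ 1793 * Λ' * (V : ℝ) ^ 2 + 704 * V :=
    card_frameLevel_le_le hK hΛ'0 hΛ'
  calc _ ≤ ((((univ : Finset (FreqMomentum V M)).filter fun k => |matsubaraFreq β M k.1| ≤ Λ' ∧ |nambuXiCT V μ K k.2| ≤ Λ').card : ℕ) : ℝ) := by
        exact_mod_cast h1.trans h2
    _ = _ := by rw [h3]; push_cast; ring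
    _ ≤ _ := mul_le_mul hT hS (Nat.cast_nonneg _) (by positivity)

/-- **Support count of the symbol INCREMENT between two admissible frames**: at most twice the one-frame count.
[cite: BenfattoGiulianiMastropietro2006, §2.8 (2.80), §3 (3.3)] -/
theorem card_support_sliceSymbolTorusIncr_le {R R' : RenConsts} {U U' : ℝ} {N N' : ℕ} {μ : ℝ} {K K' : TrigPolyC4v}
    (hK : FrameOK R U N μ K) (hK' : FrameOK R' U' N' μ K') {β : ℝ} (hβ : 0 < β) (c : ℝ) {Λ Λ' : ℝ} (hΛ : 0 < Λ) (hΛΛ' : Λ ≤ Λ')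
    (hΛ' : Λ' < 3 / 80) :
    ((((univ : Finset (TorusSite 1 (2 * M) × TorusSite 2 V)).filter fun q =>
        sliceSymbolFnXi c 0 Λ Λ' (matsubaraFreq β M ⟨(q.1 0).val, ZMod.val_lt (q.1 0)⟩) (nambuXiCT V μ K' q.2) -
          sliceSymbolFnXi c 0 Λ Λ' (matsubaraFreq β M ⟨(q.1 0).val, ZMod.val_lt (q.1 0)⟩) (nambuXiCT V μ K q.2) ≠ 0).card : ℕ) : ℝ) ≤
      2 * ((Λ' * β / π + 3) * (1793 * Λ' * (V : ℝ) ^ 2 + 704 * V)) := by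
  classical
  set A := (univ : Finset (TorusSite 1 (2 * M) × TorusSite 2 V)).filter fun q =>
    sliceSymbolFnXi c 0 Λ Λ' (matsubaraFreq β M ⟨(q.1 0).val, ZMod.val_lt (q.1 0)⟩) (nambuXiCT V μ K' q.2) ≠ 0 with hA
  set B := (univ : Finset (TorusSite 1 (2 * M) × TorusSite 2 V)).filter fun q =>
    sliceSymbolFnXi c 0 Λ Λ' (matsubaraFreq β M ⟨(q.1 0).val, ZMod.val_lt (q.1 0)⟩) (nambuXiCT V μ K q.2) ≠ 0 with hB
  have hsub : ((univ : Finset (TorusSite 1 (2 * M) × TorusSite 2 V)).filter fun q =>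
        sliceSymbolFnXi c 0 Λ Λ' (matsubaraFreq β M ⟨(q.1 0).val, ZMod.val_lt (q.1 0)⟩) (nambuXiCT V μ K' q.2) -
          sliceSymbolFnXi c 0 Λ Λ' (matsubaraFreq β M ⟨(q.1 0).val, ZMod.val_lt (q.1 0)⟩) (nambuXiCT V μ K q.2) ≠ 0) ⊆ A ∪ B := by
    intro q hq
    rw [mem_filter] at hq
    rw [Finset.mem_union, hA, hB, mem_filter, mem_filter]
    by_cases h1 : sliceSymbolFnXi c 0 Λ Λ' (matsubaraFreq β M ⟨(q.1 0).val, ZMod.val_lt (q.1 0)⟩) (nambuXiCT V μ K' q.2) = 0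
    · right
      refine ⟨mem_univ _, fun h2 => hq.2 ?_⟩
      rw [h1, h2, sub_zero]
    · left
      exact ⟨mem_univ _, h1⟩
  have hAc := card_support_sliceSymbolTorus_le (V := V) (M := M) hK' hβ c hΛ hΛΛ' hΛ'
  have hBc := card_support_sliceSymbolTorus_le (V := V) (M := M) hK hβ c hΛ hΛΛ' hΛ'
  calc _ ≤ (((A ∪ B).card : ℕ) : ℝ) := by exact_mod_cast Finset.card_le_card hsub
    _ ≤ ((A.card : ℕ) : ℝ) + ((B.card : ℕ) : ℝ) := by exact_mod_cast Finset.card_union_le A B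
    _ ≤ _ := by rw [hA, hB]; linarith

end Support

end Summit.HubbardSuperconductivity.HubbardSuperconductivity.Theorems.TorusFourierL2

end
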